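import Summits.Ventures.PercRepro.RankLevelSetPerElemSkeleton

/-! # RankLevelSetThroughMinor — THE TRIANGLE OBSTRUCTION OF (★★) IS A THROUGH-ELEMENT STATEMENT ON A MINOR OF
NULLITY ONE LESS (night-1 g37; dossier §49; on `RankLevelSetPerElemSkeleton`)

For a triangle `K = {y, a, b}` through `y`, the MEMBERS of `K` at level `j` (the absorbing `j`-sets whose circuit
with `y` is `K`) are in bijection with the bi-independent `(j − 1)`-sets of the minor `N := M ／ y ＼ a` THROUGH `b`
(`Z ↦ Z ∖ {a}`: `Z = X ∪ {a, b}` is independent iff `X ∪ {y, b}` is, by the triangle; `E ∖ Z` is independent iff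
`(E ∖ Z) ∖ {y}` is independent in `M ／ y`), and the TARGETS of `K` at level `j + 1` with the through-`b`
bi-independent `(#E − 2 − j)`-sets of `N` (`Q ↦ (E ∖ Q) ∖ {a}`) — **`members_triangle_ncard`**,
**`targets_triangle_ncard`**. The statement **(↑)** at `b` and level `k` (**`BiIndepUpAt M b k`**:
`#{W ∈ D_k : b ∈ W} ≤ #{Z ∈ D_{k+1} : b ∉ Z}`, "through `b` ≤ avoid `b` one level up", the companion of (★★) =
"avoid `y` ≤ through `y` one level up") says by complementation that the through-`b` profile is
reflection-increasing across `(#E − 1)/2` (`upAt_iff_through_le_through`); (↑) is a `Prop` here, NOT asserted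
(`BiIndepUp`); census: 0 failures on all matroids with `≤ 8` elements and on random rank-`4` duals with `10`–`13`
elements. The successor module `RankLevelSetThroughMinorFive` draws the consequence: the per-circuit inequality of
(★★) for a triangle at level `j` is exactly (↑) at level `j − 1` on the minor, and (★★) at level `5` reduces to
(↑) at level `4` on the matroids of nullity `≤ 4`. Every declaration has a docstring; imports: the cell's own
modules and Mathlib only. Axioms: standard. -/

namespace PercRepro

open Set Matroid

variable {α : Type} (M : Matroid α) [M.Finite]

/-! ## The statement (↑) -/

omit [M.Finite] in
/-- **(↑) at `b` and level `k`** (night-1 g37): `#{W ∈ D_k : b ∈ W} ≤ #{Z ∈ D_{k+1} : b ∉ Z}` — the bi-independent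
`k`-sets through `b` are at most the bi-independent `(k + 1)`-sets avoiding `b`. -/
def BiIndepUpAt (b : α) (k : ℕ) : Prop :=
  {W ∈ biIndep M k | b ∈ W}.ncard ≤ {Z ∈ biIndep M (k + 1) | b ∉ Z}.ncard

omit [M.Finite] in
/-- **(↑)** (night-1 g37; a `Prop`, NOT asserted): `BiIndepUpAt M b k` for every `b ∈ E` and every level `k` with
`2k + 2 ≤ #E`. -/
def BiIndepUp : Prop := ∀ b ∈ M.E, ∀ k : ℕ, 2 * k + 2 ≤ M.E.ncard → BiIndepUpAt M b k

/-- **The avoid-`b` sets at level `k` are the complements of the through-`b` sets at level `#E − k`.** -/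
lemma avoid_ncard_eq_through_compl {b : α} (hb : b ∈ M.E) {k : ℕ} (hk : k ≤ M.E.ncard) :
    {Z ∈ biIndep M k | b ∉ Z}.ncard = {W ∈ biIndep M (M.E.ncard - k) | b ∈ W}.ncard := by
  refine Set.ncard_congr (fun Z _ => M.E \ Z) ?_ ?_ ?_
  · rintro Z ⟨hZ, hbZ⟩
    exact ⟨mem_biIndep_compl M hZ, ⟨hb, hbZ⟩⟩
  · rintro Z T ⟨hZ, -⟩ ⟨hT, -⟩ hZT
    have h1 : M.E \ (M.E \ Z) = M.E \ (M.E \ T) := by rw [hZT]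
    rwa [Set.sdiff_sdiff_cancel_left hZ.1, Set.sdiff_sdiff_cancel_left hT.1] at h1
  · rintro W ⟨hW, hbW⟩
    refine ⟨M.E \ W, ⟨?_, fun h => h.2 hbW⟩, Set.sdiff_sdiff_cancel_left hW.1⟩
    have := mem_biIndep_compl M hW
    rwa [Nat.sub_sub_self hk] at this

/-- **(↑) at `b` and level `k` says that the through-`b` profile is reflection-increasing across `(#E − 1)/2`**:
`#{W ∈ D_k : b ∈ W} ≤ #{W ∈ D_{#E − 1 − k} : b ∈ W}`. -/
lemma upAt_iff_through_le_through {b : α} (hb : b ∈ M.E) {k : ℕ} (hk : k + 1 ≤ M.E.ncard) :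
    BiIndepUpAt M b k ↔ {W ∈ biIndep M k | b ∈ W}.ncard ≤ {W ∈ biIndep M (M.E.ncard - 1 - k) | b ∈ W}.ncard := by
  unfold BiIndepUpAt
  rw [avoid_ncard_eq_through_compl M hb hk, show M.E.ncard - (k + 1) = M.E.ncard - 1 - k by omega]

/-! ## The triangle -/

omit [M.Finite] in
/-- **The triangle swap**: if `{y, a, b}` is a circuit, `b ∈ W`, `y ∉ W`, `a ∉ W` and `insert y W` is independent,
then `insert a W` is independent (`a ∈ cl W` would put `y ∈ cl {a, b} ⊆ cl W`). -/
lemma indep_insert_of_triangle {y a b : α} (hK : M.IsCircuit {y, a, b}) {W : Set α} (hW : M.Indep (insert y W))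
    (hbW : b ∈ W) (hyW : y ∉ W) (haW : a ∉ W) : M.Indep (insert a W) := by
  have hWi : M.Indep W := hW.subset (Set.subset_insert y W)
  have haE : a ∈ M.E := hK.subset_ground (by simp)
  by_contra h
  rw [hWi.insert_indep_iff_of_notMem haW] at h
  have hacl : a ∈ M.closure W := by
    by_contra h'
    exact h ⟨haE, h'⟩
  have hy : y ∈ M.closure ({y, a, b} \ {y}) := hK.mem_closure_sdiff_singleton_of_mem (by simp)
  have hsub : ({y, a, b} : Set α) \ {y} ⊆ M.closure W := by
    intro x hx
    rcases hx with ⟨hx, hxy⟩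
    simp only [Set.mem_insert_iff, Set.mem_singleton_iff] at hx hxy
    rcases hx with rfl | rfl | rfl
    · exact absurd rfl hxy
    · exact hacl
    · exact M.subset_closure W (hWi.subset_ground) hbW
  have hycl : y ∈ M.closure W := by
    have := M.closure_subset_closure hsub hy
    rwa [M.closure_closure] at this
  rw [hWi.insert_indep_iff_of_notMem hyW] at hW
  exact hW.2 hycl

omit [M.Finite] in
/-- **The members of a triangle `{y, a, b}` at level `j`** are the bi-independent `j`-sets avoiding `y` and
containing `a` and `b`. -/
lemma mem_members_triangle_iff {y a b : α} (hK : M.IsCircuit {y, a, b}) (hya : y ≠ a) (hyb : y ≠ b) {j : ℕ}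
    {Z : Set α} :
    (Z ∈ lowAbsorbAt M y j ∧ M.fundCircuit y Z = {y, a, b}) ↔
      (Z ⊆ M.E ∧ Z.ncard = j ∧ M.Indep Z ∧ M.Indep (M.E \ Z) ∧ y ∉ Z ∧ a ∈ Z ∧ b ∈ Z) := by
  constructor
  · rintro ⟨⟨⟨hZE, hZj, hZi, hcind⟩, hyZ, -⟩, hfc⟩
    have hsub : ({y, a, b} : Set α) ⊆ insert y Z := hfc ▸ M.fundCircuit_subset_insert y Z
    have ha : a ∈ insert y Z := hsub (by simp)
    have hb : b ∈ insert y Z := hsub (by simp)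
    refine ⟨hZE, hZj, hZi, hcind, hyZ, ?_, ?_⟩
    · rcases ha with h | h
      · exact absurd h.symm hya
      · exact h
    · rcases hb with h | h
      · exact absurd h.symm hyb
      · exact h
  · rintro ⟨hZE, hZj, hZi, hcind, hyZ, haZ, hbZ⟩
    have hsub : ({y, a, b} : Set α) ⊆ insert y Z := by
      intro x hx
      simp only [Set.mem_insert_iff, Set.mem_singleton_iff] at hx
      rcases hx with rfl | rfl | rfl
      · exact Set.mem_insert _ _
      · exact Set.mem_insert_of_mem _ haZ
      · exact Set.mem_insert_of_mem _ hbZ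
    refine ⟨⟨⟨hZE, hZj, hZi, hcind⟩, hyZ, fun hi => hK.dep.not_indep (hi.subset hsub)⟩, ?_⟩
    exact (hK.eq_fundCircuit_of_subset hZi hsub).symm

omit [M.Finite] in
/-- **The targets of a triangle `{y, a, b}` at level `j + 1`** are the bi-independent `(j + 1)`-sets containing `y`
and avoiding `a` and `b`. -/
lemma mem_targets_triangle_iff {y a b : α} (hK : M.IsCircuit {y, a, b}) (hya : y ≠ a) (hyb : y ≠ b) {j : ℕ}
    {Q : Set α} :
    (Q ∈ biIndep M (j + 1) ∧ y ∈ Q ∧ ¬ M.Indep (insert y (M.E \ Q)) ∧ M.fundCircuit y (M.E \ Q) = {y, a, b}) ↔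
      (Q ⊆ M.E ∧ Q.ncard = j + 1 ∧ M.Indep Q ∧ M.Indep (M.E \ Q) ∧ y ∈ Q ∧ a ∉ Q ∧ b ∉ Q) := by
  constructor
  · rintro ⟨⟨hQE, hQj, hQi, hcind⟩, hyQ, -, hfc⟩
    have hsub : ({y, a, b} : Set α) ⊆ insert y (M.E \ Q) := hfc ▸ M.fundCircuit_subset_insert y _
    have ha : a ∈ insert y (M.E \ Q) := hsub (by simp)
    have hb : b ∈ insert y (M.E \ Q) := hsub (by simp)
    refine ⟨hQE, hQj, hQi, hcind, hyQ, ?_, ?_⟩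
    · rcases ha with h | h
      · exact absurd h.symm hya
      · exact h.2
    · rcases hb with h | h
      · exact absurd h.symm hyb
      · exact h.2
  · rintro ⟨hQE, hQj, hQi, hcind, hyQ, haQ, hbQ⟩
    have haE : a ∈ M.E := hK.subset_ground (by simp)
    have hbE : b ∈ M.E := hK.subset_ground (by simp)
    have hsub : ({y, a, b} : Set α) ⊆ insert y (M.E \ Q) := by
      intro x hx
      simp only [Set.mem_insert_iff, Set.mem_singleton_iff] at hx
      rcases hx with rfl | rfl | rfl
      · exact Set.mem_insert _ _
      · exact Set.mem_insert_of_mem _ ⟨haE, haQ⟩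
      · exact Set.mem_insert_of_mem _ ⟨hbE, hbQ⟩
    refine ⟨⟨hQE, hQj, hQi, hcind⟩, hyQ, fun hi => hK.dep.not_indep (hi.subset hsub), ?_⟩
    exact (hK.eq_fundCircuit_of_subset hcind hsub).symm

/-! ## The minor `M ／ y ＼ a` -/

omit [M.Finite] in
/-- **Independence in the minor `M ／ {y} ＼ {a}`** for a nonloop `y`: `T` avoids `y` and `a`, and `insert y T` is
independent in `M`. -/
lemma indep_contract_delete_iff_of_isNonloop {y a : α} (hy : M.IsNonloop y) (T : Set α) :
    ((M.contract {y}).delete {a}).Indep T ↔ (y ∉ T ∧ a ∉ T) ∧ M.Indep (insert y T) := by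
  rw [Matroid.delete_indep_iff, hy.contractElem_indep_iff, Set.disjoint_singleton_right]
  tauto

omit [M.Finite] in
/-- A triangle `{y, a, b}` has no loops: `y` is a nonloop. -/
lemma isNonloop_of_triangle {y a b : α} (hK : M.IsCircuit {y, a, b}) (hya : y ≠ a) : M.IsNonloop y := by
  refine Matroid.isNonloop_of_not_isLoop (hK.subset_ground (by simp)) ?_
  intro hl
  have h := hl.eq_of_isCircuit_mem hK (by simp)
  have ha : a ∈ ({y, a, b} : Set α) := by simp
  rw [h, Set.mem_singleton_iff] at ha
  exact hya ha.symm

/-- **THE MEMBERS OF A TRIANGLE ARE THE THROUGH-`b` BI-INDEPENDENT SETS OF THE MINOR ONE LEVEL DOWN**: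
`#{Z ∈ A^y_j : C_y(Z) = {y, a, b}} = #{W ∈ D_{j−1}(M ／ y ＼ a) : b ∈ W}` (`Z ↦ Z ∖ {a}`). -/
theorem members_triangle_ncard {y a b : α} (hK : M.IsCircuit {y, a, b}) (hya : y ≠ a) (hyb : y ≠ b)
    (hab : a ≠ b) {j : ℕ} (hj : 1 ≤ j) :
    {Z ∈ lowAbsorbAt M y j | M.fundCircuit y Z = {y, a, b}}.ncard =
      {W ∈ biIndep ((M.contract {y}).delete {a}) (j - 1) | b ∈ W}.ncard := by
  have hynl := isNonloop_of_triangle M hK hya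
  have hyE : y ∈ M.E := hK.subset_ground (by simp)
  have haE : a ∈ M.E := hK.subset_ground (by simp)
  have hbE : b ∈ M.E := hK.subset_ground (by simp)
  have hground := ground_contract_delete M y a
  refine Set.ncard_congr (fun Z _ => Z \ {a}) ?_ ?_ ?_
  · intro Z hZ
    rw [Set.mem_setOf_eq] at hZ
    obtain ⟨hZE, hZj, hZi, hcind, hyZ, haZ, hbZ⟩ := (mem_members_triangle_iff M hK hya hyb).mp hZ
    have hZfin : Z.Finite := M.ground_finite.subset hZE
    have hsub : ({y, a, b} : Set α) ⊆ insert y Z := by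
      intro x hx
      simp only [Set.mem_insert_iff, Set.mem_singleton_iff] at hx
      rcases hx with rfl | rfl | rfl
      · exact Set.mem_insert _ _
      · exact Set.mem_insert_of_mem _ haZ
      · exact Set.mem_insert_of_mem _ hbZ
    have hycl : y ∈ M.closure Z := by
      by_contra h
      have hi : M.Indep (insert y Z) := (hZi.insert_indep_iff_of_notMem hyZ).mpr ⟨hyE, h⟩
      exact hK.dep.not_indep (hi.subset hsub)
    refine ⟨⟨?_, ?_, ?_, ?_⟩, ⟨hbZ, by simpa using hab.symm⟩⟩
    · rw [hground]
      intro x hx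
      refine ⟨hZE hx.1, ?_⟩
      simp only [Set.mem_insert_iff, Set.mem_singleton_iff, not_or]
      constructor
      · intro h
        exact hyZ (h ▸ hx.1)
      · simpa using hx.2
    · rw [Set.ncard_sdiff_singleton_of_mem haZ, hZj]
    · rw [indep_contract_delete_iff_of_isNonloop M hynl]
      refine ⟨⟨fun h => hyZ h.1, by simp⟩, ?_⟩
      have ha : a ∈ M.fundCircuit y Z := by
        rw [hZ.2]
        simp
      rw [hZi.mem_fundCircuit_iff hycl hyZ] at ha
      rwa [Set.insert_sdiff_of_notMem _ (by simpa using hya)] at ha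
    · rw [indep_contract_delete_iff_of_isNonloop M hynl, hground]
      have heq : (M.E \ {y, a}) \ (Z \ {a}) = (M.E \ Z) \ {y} := by
        ext x
        simp only [Set.mem_sdiff, Set.mem_insert_iff, Set.mem_singleton_iff, not_or, not_and, not_not]
        constructor
        · rintro ⟨⟨hxE, hxy, hxa⟩, hx⟩
          exact ⟨⟨hxE, fun hxZ => hxa (hx hxZ)⟩, hxy⟩
        · rintro ⟨⟨hxE, hxZ⟩, hxy⟩
          exact ⟨⟨hxE, hxy, fun hxa => hxZ (hxa ▸ haZ)⟩, fun hxZ' => absurd hxZ' hxZ⟩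
      rw [heq]
      constructor
      · constructor
        · simp
        · exact fun h => h.1.2 haZ
      · have hyEZ : y ∈ M.E \ Z := ⟨hyE, hyZ⟩
        rw [Set.insert_sdiff_singleton, Set.insert_eq_of_mem hyEZ]
        exact hcind
  · intro Z T hZ hT hZT
    rw [Set.mem_setOf_eq] at hZ hT
    have haZ := ((mem_members_triangle_iff M hK hya hyb).mp hZ).2.2.2.2.2.1
    have haT := ((mem_members_triangle_iff M hK hya hyb).mp hT).2.2.2.2.2.1
    have h1 : insert a (Z \ {a}) = insert a (T \ {a}) := by rw [hZT]
    rwa [Set.insert_sdiff_self_of_mem haZ, Set.insert_sdiff_self_of_mem haT] at h1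
  · rintro W ⟨⟨hWE, hWj, hWi, hWc⟩, hbW⟩
    rw [hground] at hWE hWc
    have hyW : y ∉ W := fun h => (hWE h).2 (by simp)
    have haW : a ∉ W := fun h => (hWE h).2 (by simp)
    rw [indep_contract_delete_iff_of_isNonloop M hynl] at hWi hWc
    have hWfin : W.Finite := M.ground_finite.subset (hWE.trans Set.sdiff_subset)
    refine ⟨insert a W, ?_, Set.insert_sdiff_self_of_notMem haW⟩
    rw [Set.mem_setOf_eq, mem_members_triangle_iff M hK hya hyb]
    refine ⟨Set.insert_subset haE (hWE.trans Set.sdiff_subset), ?_, ?_, ?_, ?_, Set.mem_insert _ _,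
      Set.mem_insert_of_mem _ hbW⟩
    · rw [Set.ncard_insert_of_notMem haW hWfin, hWj]; omega
    · exact indep_insert_of_triangle M hK hWi.2 hbW hyW haW
    · have heq : M.E \ insert a W = insert y ((M.E \ {y, a}) \ W) := by
        ext x
        simp only [Set.mem_sdiff, Set.mem_insert_iff, Set.mem_singleton_iff, not_or]
        constructor
        · rintro ⟨hxE, hxa, hxW⟩
          by_cases hxy : x = y
          · exact Or.inl hxy
          · exact Or.inr ⟨⟨hxE, hxy, hxa⟩, hxW⟩
        · rintro (rfl | ⟨⟨hxE, hxy, hxa⟩, hxW⟩)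
          · exact ⟨hyE, hya, hyW⟩
          · exact ⟨hxE, hxa, hxW⟩
      rw [heq]
      exact hWc.2
    · simp only [Set.mem_insert_iff, not_or]
      exact ⟨hya, hyW⟩

/-- **THE TARGETS OF A TRIANGLE ARE THE THROUGH-`b` BI-INDEPENDENT SETS OF THE MINOR AT LEVEL `#E − 2 − j`**:
`#{Q ∈ D_{j+1} : y ∈ Q, C_y(E ∖ Q) = {y, a, b}} = #{W ∈ D_{#E − j − 2}(M ／ y ＼ a) : b ∈ W}`
(`Q ↦ (E ∖ Q) ∖ {a}`). -/
theorem targets_triangle_ncard {y a b : α} (hK : M.IsCircuit {y, a, b}) (hya : y ≠ a) (hyb : y ≠ b)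
    (hab : a ≠ b) {j : ℕ} (hj : j + 2 ≤ M.E.ncard) :
    {Q ∈ biIndep M (j + 1) | y ∈ Q ∧ ¬ M.Indep (insert y (M.E \ Q)) ∧
        M.fundCircuit y (M.E \ Q) = {y, a, b}}.ncard =
      {W ∈ biIndep ((M.contract {y}).delete {a}) (M.E.ncard - j - 2) | b ∈ W}.ncard := by
  have hynl := isNonloop_of_triangle M hK hya
  have hyE : y ∈ M.E := hK.subset_ground (by simp)
  have haE : a ∈ M.E := hK.subset_ground (by simp)
  have hbE : b ∈ M.E := hK.subset_ground (by simp)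
  have hground := ground_contract_delete M y a
  refine Set.ncard_congr (fun Q _ => (M.E \ Q) \ {a}) ?_ ?_ ?_
  · intro Q hQ
    rw [Set.mem_setOf_eq] at hQ
    obtain ⟨hQE, hQj, hQi, hcind, hyQ, haQ, hbQ⟩ := (mem_targets_triangle_iff M hK hya hyb).mp hQ
    have hQfin : Q.Finite := M.ground_finite.subset hQE
    have hsub : ({y, a, b} : Set α) ⊆ insert y (M.E \ Q) := by
      intro x hx
      simp only [Set.mem_insert_iff, Set.mem_singleton_iff] at hx
      rcases hx with rfl | rfl | rfl
      · exact Set.mem_insert _ _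
      · exact Set.mem_insert_of_mem _ ⟨haE, haQ⟩
      · exact Set.mem_insert_of_mem _ ⟨hbE, hbQ⟩
    have hyQ' : y ∉ M.E \ Q := fun h => h.2 hyQ
    have hycl : y ∈ M.closure (M.E \ Q) := by
      by_contra h
      exact hK.dep.not_indep (((hcind.insert_indep_iff_of_notMem hyQ').mpr ⟨hyE, h⟩).subset hsub)
    refine ⟨⟨?_, ?_, ?_, ?_⟩, ⟨⟨hbE, hbQ⟩, by simpa using hab.symm⟩⟩
    · rw [hground]
      intro x hx
      refine ⟨hx.1.1, ?_⟩
      simp only [Set.mem_insert_iff, Set.mem_singleton_iff, not_or]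
      constructor
      · intro h
        exact hx.1.2 (h ▸ hyQ)
      · simpa using hx.2
    · have haEQ : a ∈ M.E \ Q := ⟨haE, haQ⟩
      rw [Set.ncard_sdiff_singleton_of_mem haEQ, Set.ncard_sdiff' hQE M.ground_finite, hQj]
      omega
    · rw [indep_contract_delete_iff_of_isNonloop M hynl]
      refine ⟨⟨fun h => h.1.2 hyQ, by simp⟩, ?_⟩
      have ha : a ∈ M.fundCircuit y (M.E \ Q) := by
        rw [hQ.2.2.2]
        simp
      rw [hcind.mem_fundCircuit_iff hycl hyQ'] at ha
      rwa [Set.insert_sdiff_of_notMem _ (by simpa using hya)] at ha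
    · rw [indep_contract_delete_iff_of_isNonloop M hynl, hground]
      have heq : (M.E \ {y, a}) \ ((M.E \ Q) \ {a}) = Q \ {y} := by
        ext x
        simp only [Set.mem_sdiff, Set.mem_insert_iff, Set.mem_singleton_iff, not_or, not_and, not_not]
        constructor
        · rintro ⟨⟨hxE, hxy, hxa⟩, hx⟩
          refine ⟨?_, hxy⟩
          by_contra hxQ
          exact hxa (hx ⟨hxE, hxQ⟩)
        · rintro ⟨hxQ, hxy⟩
          exact ⟨⟨hQE hxQ, hxy, fun hxa => haQ (hxa ▸ hxQ)⟩, fun hx => absurd hxQ hx.2⟩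
      rw [heq]
      constructor
      · constructor
        · simp
        · exact fun h => haQ h.1
      · rw [Set.insert_sdiff_singleton, Set.insert_eq_of_mem hyQ]
        exact hQi
  · intro Q R hQ hR hQR
    rw [Set.mem_setOf_eq] at hQ hR
    have hQ' := (mem_targets_triangle_iff M hK hya hyb).mp hQ
    have hR' := (mem_targets_triangle_iff M hK hya hyb).mp hR
    have haQ : a ∈ M.E \ Q := ⟨haE, hQ'.2.2.2.2.2.1⟩
    have haR : a ∈ M.E \ R := ⟨haE, hR'.2.2.2.2.2.1⟩
    have h1 : insert a ((M.E \ Q) \ {a}) = insert a ((M.E \ R) \ {a}) := by rw [hQR]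
    rw [Set.insert_sdiff_self_of_mem haQ, Set.insert_sdiff_self_of_mem haR] at h1
    have h2 : M.E \ (M.E \ Q) = M.E \ (M.E \ R) := by rw [h1]
    rwa [Set.sdiff_sdiff_cancel_left hQ'.1, Set.sdiff_sdiff_cancel_left hR'.1] at h2
  · rintro W ⟨⟨hWE, hWj, hWi, hWc⟩, hbW⟩
    rw [hground] at hWE hWc
    have hyW : y ∉ W := fun h => (hWE h).2 (by simp)
    have haW : a ∉ W := fun h => (hWE h).2 (by simp)
    rw [indep_contract_delete_iff_of_isNonloop M hynl] at hWi hWc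
    have hWE' : W ⊆ M.E := hWE.trans Set.sdiff_subset
    have hWfin : W.Finite := M.ground_finite.subset hWE'
    have haWE : insert a W ⊆ M.E := Set.insert_subset haE hWE'
    have hcompl : M.E \ (M.E \ insert a W) = insert a W := Set.sdiff_sdiff_cancel_left haWE
    refine ⟨M.E \ insert a W, ?_, by rw [hcompl, Set.insert_sdiff_self_of_notMem haW]⟩
    rw [Set.mem_setOf_eq, mem_targets_triangle_iff M hK hya hyb]
    have heq : M.E \ insert a W = insert y ((M.E \ {y, a}) \ W) := by
      ext x
      simp only [Set.mem_sdiff, Set.mem_insert_iff, Set.mem_singleton_iff, not_or]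
      constructor
      · rintro ⟨hxE, hxa, hxW⟩
        by_cases hxy : x = y
        · exact Or.inl hxy
        · exact Or.inr ⟨⟨hxE, hxy, hxa⟩, hxW⟩
      · rintro (rfl | ⟨⟨hxE, hxy, hxa⟩, hxW⟩)
        · exact ⟨hyE, hya, hyW⟩
        · exact ⟨hxE, hxa, hxW⟩
    refine ⟨Set.sdiff_subset, ?_, ?_, ?_, ⟨hyE, by simp only [Set.mem_insert_iff, not_or]; exact ⟨hya, hyW⟩⟩,
      fun h => h.2 (Set.mem_insert _ _), fun h => h.2 (Set.mem_insert_of_mem _ hbW)⟩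
    · rw [Set.ncard_sdiff' haWE M.ground_finite, Set.ncard_insert_of_notMem haW hWfin, hWj]
      omega
    · rw [heq]; exact hWc.2
    · rw [hcompl]
      exact indep_insert_of_triangle M hK hWi.2 hbW hyW haW

end PercRepro
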